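import Summits.RiemannHypothesis.RiemannHypothesis.Theorems.TiltedLandingLaw421R3SinkK1LidA
import Summits.RiemannHypothesis.RiemannHypothesis.Theorems.TiltedLandingLaw421R3SinkK1LidB
import Summits.RiemannHypothesis.RiemannHypothesis.Theorems.TiltedLandingLaw421R3SinkK1LidC
import Summits.RiemannHypothesis.RiemannHypothesis.Theorems.TiltedLandingLaw421R3SinkK1Near

/-!
# C3 (rh-idea-3 g56/g57) — «K1LidLink»: the two LIDS of K1 (rule `y0 = 1`, `R = 2`, MAIN) over 110's closed forms — identity + sign bookkeeping + ★ the two lid theorems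

Packing per director (CA1023)(3): imports EXACTLY the three lid-certificate targets «K1LidA/B/C» (`RhW08.K1LidBox.g0_pos_box, c1_pos_box … c8_pos_box`; 110 = #1261
arrives transitively) PLUS #1272 «K1Near», whose `RhW08.K1NearColumnLink.cornerSigmaForm_two` is CITED BY NAME (not restated) in `lid_dom_of_key`.
Namespace `RhW08.K1Lid`.  Content (g56's `K1LidT` §B, with the ONE `set_option maxHeartbeats 4000000` of its `lid_identity` REMOVED by g57's split, `g57/eng/lidsplit.py`,
every piece verified exactly in ℚ first): `twoPointNForm_one_lid` (at `y0 = 1` the `h`-terms of `twoPointNForm` carry the factor `1 − y0 = 0`), the cleared forms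
`lidNN`/`lidCC` with (N) `twoPointNForm_lid_mul`, (C) `pairCForm_lid_mul` (small `field_simp; ring`, four resp. two denominators, no `h`), `lidSum` (the certificate
sum `Σₖ C(8,k)·cₖ·(ξ+1)ᵏ(ξ−1)⁸⁻ᵏ`, `c₀ = d·g0`), (P) `lid_poly_identity` (ONE pure `ring`: `(lidNN(1)·lidCC(ξ)·A₁A₂(ξ) − lidNN(ξ)·lidCC(1)·A₁A₂(1))·256ξ³ = t·d·(ξ−1)·lidSum`),
and `lid_identity` (g56's statement VERBATIM) assembled from (N)(C)(P) by `linear_combination`; then `pairCForm_lid_pos`, `lidSum_nonneg_right/left` (nine one-box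
certificates + sign bookkeeping: `ξ ≥ 1` trivial; `ξ ≤ −1` via `m = −1−ξ ≥ 0`, `(ξ+1)ᵏ(ξ−1)⁸⁻ᵏ = mᵏ(m+2)⁸⁻ᵏ`), `lid_dom_of_key`, `lid_denoms_pos`,
★`right_lid_K1_main` (conjunct 3 of 110's `BdryDomForm 2 d t h 1 (cornerSigmaForm 2 d t h 1)`: `∀ ξ ≥ 1`) and ★`left_lid_K1_main` (conjunct 4: `1 ≤ −ξ`), both for right-sided
strict cone children on MAIN `t ∈ [1/8, 2/3]`, `d ∈ [0, 33/128]`, σ used on both lids = the NEAR-corner ratio (`le_max_left`).  0 `sorry`; 0 `set_option`.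
Level: SUPPORT (K + certified inequalities; asserts no law; no 102/110/113/120/121/122 vocabulary re-declared).  Nothing here bears on the truth of RH; RH is not proved; ⟨33346⟩/⟨33347⟩ OPEN; a certified polynomial inequality on a rectangle decides nothing about ξ.
-/

noncomputable section

namespace RhW08.K1Lid

open RhW08.SinkBdry RhW08.K1LidBox

/-- at rule `y0 = 1` the `h`-terms of 110's `twoPointNForm` carry the factor `1 − y0 = 0`: an `h`-free closed form (lid row `b = 1`). -/
theorem twoPointNForm_one_lid (d t h ξ : ℝ) :
    twoPointNForm d t h 1 ξ 1 = -(ξ * (1 / (ξ ^ 2 + (t - 1) ^ 2) + 1 / (ξ ^ 2 + (t + 1) ^ 2)))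
      - (d - ξ) * (1 / ((d - ξ) ^ 2 + (t - 1) ^ 2) + 1 / ((d - ξ) ^ 2 + (t + 1) ^ 2)) := by
  unfold twoPointNForm; ring

/-- the cleared lid numerator `N(ξ,1)·(A₁A₂)·(M₁M₂)` (kept factored; `A_i = ξ² + (t ∓ 1)²`, `M_i = (d − ξ)² + (t ∓ 1)²`). -/
def lidNN (ξ t d : ℝ) : ℝ :=
  -(ξ * ((ξ ^ 2 + (t - 1) ^ 2) + (ξ ^ 2 + (t + 1) ^ 2)) * (((d - ξ) ^ 2 + (t - 1) ^ 2) * ((d - ξ) ^ 2 + (t + 1) ^ 2)))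
    - (d - ξ) * (((d - ξ) ^ 2 + (t - 1) ^ 2) + ((d - ξ) ^ 2 + (t + 1) ^ 2)) * ((ξ ^ 2 + (t - 1) ^ 2) * (ξ ^ 2 + (t + 1) ^ 2))

/-- the cleared lid `c`: `c(ξ,1)·M₁M₂ = lidCC = 2t((d − ξ)² + t² − 1)`. -/
def lidCC (ξ t d : ℝ) : ℝ :=
  2 * t * ((d - ξ) ^ 2 + t ^ 2 - 1)

/-- (N) `N(ξ,1)·((A₁A₂)(M₁M₂)) = lidNN` whenever `ξ² > 0` and `(d − ξ)² > 0` (both lids, and the near top corner `ξ = 1`, `d < 1`). -/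
theorem twoPointNForm_lid_mul (d t h ξ : ℝ) (hξ : 0 < ξ ^ 2) (hM : 0 < (d - ξ) ^ 2) :
    twoPointNForm d t h 1 ξ 1 * (((ξ ^ 2 + (t - 1) ^ 2) * (ξ ^ 2 + (t + 1) ^ 2)) * (((d - ξ) ^ 2 + (t - 1) ^ 2) * ((d - ξ) ^ 2 + (t + 1) ^ 2)))
      = lidNN ξ t d := by
  have h1 : ξ ^ 2 + (t - 1) ^ 2 ≠ 0 := by nlinarith [sq_nonneg (t - 1)]
  have h2 : ξ ^ 2 + (t + 1) ^ 2 ≠ 0 := by nlinarith [sq_nonneg (t + 1)]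
  have h3 : (d - ξ) ^ 2 + (t - 1) ^ 2 ≠ 0 := by nlinarith [sq_nonneg (t - 1)]
  have h4 : (d - ξ) ^ 2 + (t + 1) ^ 2 ≠ 0 := by nlinarith [sq_nonneg (t + 1)]
  rw [twoPointNForm_one_lid]
  unfold lidNN
  field_simp
  ring

/-- (C) `c(ξ,1)·(M₁M₂) = lidCC` for `(d − ξ)² > 0`. -/
theorem pairCForm_lid_mul (d t ξ : ℝ) (hM : 0 < (d - ξ) ^ 2) :
    pairCForm d t ξ 1 * (((d - ξ) ^ 2 + (t - 1) ^ 2) * ((d - ξ) ^ 2 + (t + 1) ^ 2)) = lidCC ξ t d := by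
  have h3 : (d - ξ) ^ 2 + (t - 1) ^ 2 ≠ 0 := by nlinarith [sq_nonneg (t - 1)]
  have h4 : (d - ξ) ^ 2 + (t + 1) ^ 2 ≠ 0 := by nlinarith [sq_nonneg (t + 1)]
  unfold pairCForm lidCC
  field_simp
  ring

/-- the lid certificate sum `Σₖ C(8,k)·cₖ(t,d)·(ξ+1)ᵏ·(ξ−1)⁸⁻ᵏ` with `c₀ = d·g0`. -/
def lidSum (t d ξ : ℝ) : ℝ :=
  d * g0 t d * (ξ - 1) ^ 8 + 8 * c1 t d * (ξ + 1) * (ξ - 1) ^ 7 + 28 * c2 t d * (ξ + 1) ^ 2 * (ξ - 1) ^ 6 +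
    56 * c3 t d * (ξ + 1) ^ 3 * (ξ - 1) ^ 5 + 70 * c4 t d * (ξ + 1) ^ 4 * (ξ - 1) ^ 4 + 56 * c5 t d * (ξ + 1) ^ 5 * (ξ - 1) ^ 3 +
    28 * c6 t d * (ξ + 1) ^ 6 * (ξ - 1) ^ 2 + 8 * c7 t d * (ξ + 1) ^ 7 * (ξ - 1) + c8 t d * (ξ + 1) ^ 8

/-- (P) THE LID POLYNOMIAL IDENTITY (pure `ring`, no denominators, no `h`): `(lidNN(1)·lidCC(ξ)·A₁A₂(ξ) − lidNN(ξ)·lidCC(1)·A₁A₂(1))·256ξ³ = t·d·(ξ−1)·lidSum`. -/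
theorem lid_poly_identity (t d ξ : ℝ) :
    (lidNN 1 t d * lidCC ξ t d * ((ξ ^ 2 + (t - 1) ^ 2) * (ξ ^ 2 + (t + 1) ^ 2)) - lidNN ξ t d * lidCC 1 t d * ((1 + (t - 1) ^ 2) * (1 + (t + 1) ^ 2))) * (256 * ξ ^ 3)
      = t * d * ((ξ - 1) * lidSum t d ξ) := by
  unfold lidNN lidCC lidSum g0 c1 c2 c3 c4 c5 c6 c7 c8
  ring

/-- LID IDENTITY (K): `(N(1,1)·c(ξ,1) − N(ξ,1)·c(1,1)) · (A₁A₂M₁M₂)(1) · (A₁A₂M₁M₂)(ξ) · 256ξ³ = t·d·(ξ−1)·lidSum`, denominators cleared (`ξ² ≥ 1`, `0 ≤ d < 1`);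
assembled from (N), (C) and the polynomial identity (P) by `linear_combination` — no `field_simp` on the big expression, no `set_option`. -/
theorem lid_identity (d t h ξ : ℝ) (hd0 : 0 ≤ d) (hd : d < 1) (hξ : 1 ≤ ξ ^ 2) :
    (twoPointNForm d t h 1 1 1 * pairCForm d t ξ 1 - twoPointNForm d t h 1 ξ 1 * pairCForm d t 1 1)
      * (((1 + (t - 1) ^ 2) * (1 + (t + 1) ^ 2)) * (((d - 1) ^ 2 + (t - 1) ^ 2) * ((d - 1) ^ 2 + (t + 1) ^ 2)))
      * (((ξ ^ 2 + (t - 1) ^ 2) * (ξ ^ 2 + (t + 1) ^ 2)) * (((d - ξ) ^ 2 + (t - 1) ^ 2) * ((d - ξ) ^ 2 + (t + 1) ^ 2)))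
      * (256 * ξ ^ 3)
    = t * d * ((ξ - 1) * lidSum t d ξ) := by
  have hne : d - ξ ≠ 0 := by
    intro h0
    have e : ξ = d := by linarith
    rw [e] at hξ
    nlinarith
  have hM : 0 < (d - ξ) ^ 2 := lt_of_le_of_ne (sq_nonneg _) (Ne.symm (pow_ne_zero 2 hne))
  have hM1 : 0 < (d - 1) ^ 2 := by
    rw [show (d - 1) ^ 2 = (1 - d) ^ 2 by ring]; exact pow_pos (by linarith) 2
  have hξ2 : 0 < ξ ^ 2 := by linarith
  have eN1 := twoPointNForm_lid_mul d t h 1 (by norm_num) hM1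
  have eNx := twoPointNForm_lid_mul d t h ξ hξ2 hM
  have eC1 := pairCForm_lid_mul d t 1 hM1
  have eCx := pairCForm_lid_mul d t ξ hM
  have eP := lid_poly_identity t d ξ
  simp only [one_pow] at eN1 eC1
  rw [← eP]
  linear_combination ((((d - ξ) ^ 2 + (t - 1) ^ 2) * ((d - ξ) ^ 2 + (t + 1) ^ 2)) * ((ξ ^ 2 + (t - 1) ^ 2) * (ξ ^ 2 + (t + 1) ^ 2)) * (256 * ξ ^ 3) * pairCForm d t ξ 1) * eN1
    - ((((d - 1) ^ 2 + (t - 1) ^ 2) * ((d - 1) ^ 2 + (t + 1) ^ 2)) * ((1 + (t - 1) ^ 2) * (1 + (t + 1) ^ 2)) * (256 * ξ ^ 3) * pairCForm d t 1 1) * eNx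
    + (lidNN 1 t d * ((ξ ^ 2 + (t - 1) ^ 2) * (ξ ^ 2 + (t + 1) ^ 2)) * (256 * ξ ^ 3)) * eCx
    - (lidNN ξ t d * ((1 + (t - 1) ^ 2) * (1 + (t + 1) ^ 2)) * (256 * ξ ^ 3)) * eC1

/-- `c(ξ,1) > 0` whenever `(1 − d)² ≤ (d − ξ)²` on a strict cone child (covers both lids and the near top corner `ξ = 1`). -/
theorem pairCForm_lid_pos (d t ξ : ℝ) (hd : d < 1) (ht : 0 < t) (hcone : d * (2 - d) < t ^ 2) (hfar : (1 - d) ^ 2 ≤ (d - ξ) ^ 2) :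
    0 < pairCForm d t ξ 1 := by
  have hdd : 0 < (1 - d) ^ 2 := pow_pos (by linarith) 2
  have hM : 0 < (d - ξ) ^ 2 := lt_of_lt_of_le hdd hfar
  have hE : 0 < ((d - ξ) ^ 2 + (t - 1) ^ 2) * ((d - ξ) ^ 2 + (t + 1) ^ 2) :=
    mul_pos (add_pos_of_pos_of_nonneg hM (sq_nonneg _)) (add_pos_of_pos_of_nonneg hM (sq_nonneg _))
  have hnum : 0 < lidCC ξ t d := by
    have : 0 < (d - ξ) ^ 2 + t ^ 2 - 1 := by nlinarith
    unfold lidCC; positivity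
  have := pairCForm_lid_mul d t ξ hM
  rw [← this] at hnum
  exact (mul_pos_iff_of_pos_right hE).1 hnum

/-- `lidSum ≥ 0` on the RIGHT lid ray `ξ ≥ 1` (MAIN: the nine pieces are positive by their one-box certificates). -/
theorem lidSum_nonneg_right (t d ξ : ℝ) (ht₁ : ((1 : ℝ) / 8) ≤ t) (ht₂ : t ≤ ((2 : ℝ) / 3)) (hd₁ : (0 : ℝ) ≤ d) (hd₂ : d ≤ ((33 : ℝ) / 128))
    (hξ : 1 ≤ ξ) : 0 ≤ lidSum t d ξ := by
  have e0 := g0_pos_box t d ht₁ ht₂ hd₁ hd₂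
  have e1 := c1_pos_box t d ht₁ ht₂ hd₁ hd₂
  have e2 := c2_pos_box t d ht₁ ht₂ hd₁ hd₂
  have e3 := c3_pos_box t d ht₁ ht₂ hd₁ hd₂
  have e4 := c4_pos_box t d ht₁ ht₂ hd₁ hd₂
  have e5 := c5_pos_box t d ht₁ ht₂ hd₁ hd₂
  have e6 := c6_pos_box t d ht₁ ht₂ hd₁ hd₂
  have e7 := c7_pos_box t d ht₁ ht₂ hd₁ hd₂
  have e8 := c8_pos_box t d ht₁ ht₂ hd₁ hd₂
  have hp : 0 ≤ ξ - 1 := by linarith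
  have hq : 0 ≤ ξ + 1 := by linarith
  unfold lidSum
  generalize g0 t d = G0 at e0; generalize c1 t d = C1 at e1; generalize c2 t d = C2 at e2; generalize c3 t d = C3 at e3
  generalize c4 t d = C4 at e4; generalize c5 t d = C5 at e5; generalize c6 t d = C6 at e6; generalize c7 t d = C7 at e7
  generalize c8 t d = C8 at e8
  generalize ξ - 1 = p at hp; generalize ξ + 1 = q at hq
  positivity

/-- `lidSum ≥ 0` on the LEFT lid ray `ξ ≤ −1` (`(ξ+1)ᵏ(ξ−1)⁸⁻ᵏ = mᵏ n⁸⁻ᵏ` with `m = −1−ξ ≥ 0`, `n = 1−ξ ≥ 0`). -/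
theorem lidSum_nonneg_left (t d ξ : ℝ) (ht₁ : ((1 : ℝ) / 8) ≤ t) (ht₂ : t ≤ ((2 : ℝ) / 3)) (hd₁ : (0 : ℝ) ≤ d) (hd₂ : d ≤ ((33 : ℝ) / 128))
    (hξ : ξ ≤ -1) : 0 ≤ lidSum t d ξ := by
  have e0 := g0_pos_box t d ht₁ ht₂ hd₁ hd₂
  have e1 := c1_pos_box t d ht₁ ht₂ hd₁ hd₂
  have e2 := c2_pos_box t d ht₁ ht₂ hd₁ hd₂
  have e3 := c3_pos_box t d ht₁ ht₂ hd₁ hd₂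
  have e4 := c4_pos_box t d ht₁ ht₂ hd₁ hd₂
  have e5 := c5_pos_box t d ht₁ ht₂ hd₁ hd₂
  have e6 := c6_pos_box t d ht₁ ht₂ hd₁ hd₂
  have e7 := c7_pos_box t d ht₁ ht₂ hd₁ hd₂
  have e8 := c8_pos_box t d ht₁ ht₂ hd₁ hd₂
  obtain ⟨m, hm, hξm⟩ : ∃ m : ℝ, 0 ≤ m ∧ ξ = -1 - m := ⟨-1 - ξ, by linarith, by ring⟩
  have e : lidSum t d ξ = d * g0 t d * (m + 2) ^ 8 + 8 * c1 t d * m * (m + 2) ^ 7 + 28 * c2 t d * m ^ 2 * (m + 2) ^ 6 +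
      56 * c3 t d * m ^ 3 * (m + 2) ^ 5 + 70 * c4 t d * m ^ 4 * (m + 2) ^ 4 + 56 * c5 t d * m ^ 5 * (m + 2) ^ 3 +
      28 * c6 t d * m ^ 6 * (m + 2) ^ 2 + 8 * c7 t d * m ^ 7 * (m + 2) + c8 t d * m ^ 8 := by
    subst hξm; unfold lidSum; ring
  rw [e]
  generalize g0 t d = G0 at e0; generalize c1 t d = C1 at e1; generalize c2 t d = C2 at e2; generalize c3 t d = C3 at e3
  generalize c4 t d = C4 at e4; generalize c5 t d = C5 at e5; generalize c6 t d = C6 at e6; generalize c7 t d = C7 at e7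
  generalize c8 t d = C8 at e8
  positivity

/-- from `0 ≤ N(1,1)·c(ξ,1) − N(ξ,1)·c(1,1)` and the two `c > 0` facts to the lid inequality with `σ* = cornerSigmaForm` (120's `RhW08.K1NearColumnLink.cornerSigmaForm_two`, cited by name). -/
theorem lid_dom_of_key (d t h ξ : ℝ) (hc1 : 0 < pairCForm d t 1 1) (hcξ : 0 ≤ pairCForm d t ξ 1)
    (key : 0 ≤ twoPointNForm d t h 1 1 1 * pairCForm d t ξ 1 - twoPointNForm d t h 1 ξ 1 * pairCForm d t 1 1) :
    twoPointNForm d t h 1 ξ 1 ≤ cornerSigmaForm 2 d t h 1 * pairCForm d t ξ 1 := by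
  have step1 : twoPointNForm d t h 1 ξ 1 ≤ (twoPointNForm d t h 1 1 1 / pairCForm d t 1 1) * pairCForm d t ξ 1 := by
    rw [div_mul_eq_mul_div, le_div_iff₀ hc1]
    linarith
  have step2 : (twoPointNForm d t h 1 1 1 / pairCForm d t 1 1) * pairCForm d t ξ 1 ≤ cornerSigmaForm 2 d t h 1 * pairCForm d t ξ 1 := by
    rw [RhW08.K1NearColumnLink.cornerSigmaForm_two]
    exact mul_le_mul_of_nonneg_right (le_max_left _ _) hcξ
  exact step1.trans step2

/-- the common positive factor `D(1)·D(ξ)` of the lid identity. -/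
theorem lid_denoms_pos (d t ξ : ℝ) (hd : d < 1) (hM : 0 < (d - ξ) ^ 2) (hξ : 1 ≤ ξ ^ 2) :
    0 < (((1 + (t - 1) ^ 2) * (1 + (t + 1) ^ 2)) * (((d - 1) ^ 2 + (t - 1) ^ 2) * ((d - 1) ^ 2 + (t + 1) ^ 2)))
      ∧ 0 < (((ξ ^ 2 + (t - 1) ^ 2) * (ξ ^ 2 + (t + 1) ^ 2)) * (((d - ξ) ^ 2 + (t - 1) ^ 2) * ((d - ξ) ^ 2 + (t + 1) ^ 2))) := by
  have hdd : 0 < (d - 1) ^ 2 := by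
    rw [show (d - 1) ^ 2 = (1 - d) ^ 2 by ring]; exact pow_pos (by linarith) 2
  have hξ2 : 0 < ξ ^ 2 := by linarith
  exact ⟨mul_pos (by positivity) (mul_pos (add_pos_of_pos_of_nonneg hdd (sq_nonneg _)) (add_pos_of_pos_of_nonneg hdd (sq_nonneg _))),
    mul_pos (mul_pos (add_pos_of_pos_of_nonneg hξ2 (sq_nonneg _)) (add_pos_of_pos_of_nonneg hξ2 (sq_nonneg _)))
      (mul_pos (add_pos_of_pos_of_nonneg hM (sq_nonneg _)) (add_pos_of_pos_of_nonneg hM (sq_nonneg _)))⟩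

/-- ★ RIGHT LID K1 ON MAIN (PROVED, R = 2): conjunct 3 of `BdryDomForm 2 d t h 1 (cornerSigmaForm 2 d t h 1)` for a right-sided strict cone child on MAIN. -/
theorem right_lid_K1_main (d t h ξ : ℝ) (ht₁ : ((1 : ℝ) / 8) ≤ t) (ht₂ : t ≤ ((2 : ℝ) / 3)) (hd₁ : (0 : ℝ) ≤ d) (hd₂ : d ≤ ((33 : ℝ) / 128))
    (hcone : d * (2 - d) < t ^ 2) (hξ : 1 ≤ ξ) :
    twoPointNForm d t h 1 ξ 1 ≤ cornerSigmaForm 2 d t h 1 * pairCForm d t ξ 1 := by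
  have hd : d < 1 := by linarith
  have ht : 0 < t := by linarith
  have hξ2 : 1 ≤ ξ ^ 2 := by nlinarith
  have hfar : (1 - d) ^ 2 ≤ (d - ξ) ^ 2 := by nlinarith [mul_nonneg (sub_nonneg.mpr hξ) (by linarith : (0:ℝ) ≤ ξ + 1 - 2 * d)]
  have hM : 0 < (d - ξ) ^ 2 := lt_of_lt_of_le (pow_pos (by linarith) 2) hfar
  have hξ0 : 0 < ξ := by linarith
  have h256 : (0:ℝ) < 256 * ξ ^ 3 := by positivity
  have hrhs : 0 ≤ t * d * ((ξ - 1) * lidSum t d ξ) :=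
    mul_nonneg (mul_nonneg ht.le hd₁) (mul_nonneg (by linarith) (lidSum_nonneg_right t d ξ ht₁ ht₂ hd₁ hd₂ hξ))
  have hc1 : 0 < pairCForm d t 1 1 := pairCForm_lid_pos d t 1 hd ht hcone (le_of_eq (by ring))
  have hcξ := (pairCForm_lid_pos d t ξ hd ht hcone hfar).le
  obtain ⟨hP1, hP2⟩ := lid_denoms_pos d t ξ hd hM hξ2
  have iden := lid_identity d t h ξ hd₁ hd hξ2
  have key : 0 ≤ twoPointNForm d t h 1 1 1 * pairCForm d t ξ 1 - twoPointNForm d t h 1 ξ 1 * pairCForm d t 1 1 := by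
    rw [← iden] at hrhs
    exact (mul_nonneg_iff_of_pos_right hP1).1 ((mul_nonneg_iff_of_pos_right hP2).1 ((mul_nonneg_iff_of_pos_right h256).1 hrhs))
  exact lid_dom_of_key d t h ξ hc1 hcξ key

/-- ★ LEFT LID K1 ON MAIN (PROVED, R = 2): conjunct 4 of `BdryDomForm 2 d t h 1 (cornerSigmaForm 2 d t h 1)` (`1 ≤ −ξ`), same σ = near-corner ratio. -/
theorem left_lid_K1_main (d t h ξ : ℝ) (ht₁ : ((1 : ℝ) / 8) ≤ t) (ht₂ : t ≤ ((2 : ℝ) / 3)) (hd₁ : (0 : ℝ) ≤ d) (hd₂ : d ≤ ((33 : ℝ) / 128))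
    (hcone : d * (2 - d) < t ^ 2) (hξ : 1 ≤ -ξ) :
    twoPointNForm d t h 1 ξ 1 ≤ cornerSigmaForm 2 d t h 1 * pairCForm d t ξ 1 := by
  have hd : d < 1 := by linarith
  have ht : 0 < t := by linarith
  have hξ' : ξ ≤ -1 := by linarith
  have hξ2 : 1 ≤ ξ ^ 2 := by nlinarith
  have hfar : (1 - d) ^ 2 ≤ (d - ξ) ^ 2 := by nlinarith [mul_nonneg (by linarith : (0:ℝ) ≤ 2 * d - ξ - 1) (by linarith : (0:ℝ) ≤ 1 - ξ)]
  have hM : 0 < (d - ξ) ^ 2 := lt_of_lt_of_le (pow_pos (by linarith) 2) hfar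
  have hξ2pos : 0 < ξ ^ 2 := lt_of_lt_of_le one_pos hξ2
  have hneg : 256 * ξ ^ 3 < 0 := by
    have h3 : ξ * ξ ^ 2 < 0 := mul_neg_of_neg_of_pos (by linarith) hξ2pos
    rw [show ξ ^ 3 = ξ * ξ ^ 2 by ring]; linarith
  have hL := lidSum_nonneg_left t d ξ ht₁ ht₂ hd₁ hd₂ hξ'
  have hy : 0 ≤ t * d * ((1 - ξ) * lidSum t d ξ) := mul_nonneg (mul_nonneg ht.le hd₁) (mul_nonneg (by linarith) hL)
  have hrhs : t * d * ((ξ - 1) * lidSum t d ξ) ≤ 0 := by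
    rw [show t * d * ((ξ - 1) * lidSum t d ξ) = -(t * d * ((1 - ξ) * lidSum t d ξ)) by ring]; linarith
  have aux : ∀ {Y z : ℝ}, Y * z ≤ 0 → z < 0 → 0 ≤ Y := by
    intro Y z hYz hz
    by_contra h'
    push Not at h'
    nlinarith [mul_pos_of_neg_of_neg h' hz]
  have hc1 : 0 < pairCForm d t 1 1 := pairCForm_lid_pos d t 1 hd ht hcone (le_of_eq (by ring))
  have hcξ := (pairCForm_lid_pos d t ξ hd ht hcone hfar).le
  obtain ⟨hP1, hP2⟩ := lid_denoms_pos d t ξ hd hM hξ2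
  have iden := lid_identity d t h ξ hd₁ hd hξ2
  have key : 0 ≤ twoPointNForm d t h 1 1 1 * pairCForm d t ξ 1 - twoPointNForm d t h 1 ξ 1 * pairCForm d t 1 1 := by
    rw [← iden] at hrhs
    exact (mul_nonneg_iff_of_pos_right hP1).1 ((mul_nonneg_iff_of_pos_right hP2).1 (aux hrhs hneg))
  exact lid_dom_of_key d t h ξ hc1 hcξ key

end RhW08.K1Lid

end
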